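import Mathlib
import Literature.Analysis.FluidPDE.VectorCalculus
import Literature.Analysis.FluidPDE.SverakLandauClassification
import Summits.NavierStokesRegularity.NavierStokesRegularity.Theorems.ThreadingFluxCentreJetDefs
import Summits.NavierStokesRegularity.NavierStokesRegularity.Theorems.ThreadingFluxAzimuthalCartanLandauBaseTools
import HarnessLib

/-!
# Crux `PoloidalLiouville` (stmt-NavierStokesRegularity-1222, W1), crux idea «azimuthal-cartan-test» (ns-idea-15 g10, V26):
# (L) `LandauBaseFacts` — the Landau flow is an admissible axisymmetric base of the Cartan jet count (v1.3b: on the solid torus),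
# and the off-vertex ball version `hL` of `ballRigidity_refuted_landau`

The sketch `Cruxes/PoloidalLiouville/AzimuthalCartanSketch.lean` (v1.3b, 2b7b372f8101947e, l.339) types

`LandauBaseFacts : IsAxisymmetricBaseOn landauTorus 0 J3 landau2 landauPressure2`, where
`IsAxisymmetricBaseOn U x₀ A V p := AnalyticOnNhd ℝ V U ∧ AnalyticOnNhd ℝ p U ∧ IsSteadyNSOn U V p ∧ IsSkewAxis A ∧
   IsEquivariantOn U x₀ A V ∧ (∀ x ∈ U, ⟪V x, A (x − x₀)⟫ = 0) ∧ ∃ x ∈ U, curl V x ≠ 0`,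

`landau2 = landauAxisField e₂ 2`, `landauPressure2 = landauAxisPressure e₂ 2` (tree, Šverák 2011 (4.7)), `J3 = crossCLM e₂`,
`landauTorus = solidTorus 0 e3 (3,4) 1 = {x | dist (axialCoords 0 e₂ x) (3,4) < 1}` (the rotation-invariant solid torus through the test
point `x₁ = (3,0,4)`; sup-metric on `ℝ × ℝ`), `IsSteadyNSOn` the tree's (`ThreadingFluxCentreJetDefs`), and the sketch-local
`IsSkewAxis A := (∀ x, ⟪A x, x⟫ = 0) ∧ A ≠ 0`, `IsEquivariantOn U x₀ A W := ∀ x ∈ U, DW(x)(A(x − x₀)) = A (W x)`.  This file proves it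
with ALL sketch-local abbreviations δ-unfolded into tree vocabulary (`landauBaseFacts`; the defeq one-liner
`landauBaseFacts_holds : LandauBaseFacts := landauBaseFacts` is checked in the dev probe against verbatim copies), and also the
hypothesis `hL` of the sketch's `ballRigidity_refuted_landau` — the same base facts on `ball x₁ ρ`, `0 < ρ ≤ 1`, about the OFF-VERTEX
centre `e₂`, together with `¬ IsMinusOneHomogeneousOn (ball x₁ ρ) e₂ landau2` (`landauBaseFacts_ball_offVertex`).  Tree tools only:

* analyticity off the origin: the tree's `LandauTail.contDiffAt_landauAxisField/Pressure` hold for every `n : WithTop ℕ∞`, in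
  particular `n = ω`, and `ContDiffAt ℝ ω` IS real-analyticity (`ContDiffAt.analyticAt`); torus and balls miss the origin;
* steady NS: `LandauTail.landauAxisField_momentum` (`(U·∇)U + ∇P = ΔU` off the origin, Landau 1944) and
  `LandauTail.divergence_landauAxisField`;
* `J₃ = e₂ × · = rotGen` is skew and non-zero and kills the axis (`J₃ (x − t e₂) = J₃ x`); infinitesimal equivariance
  `DU(x)(e₂ × x) = e₂ × U(x)` is `IsAxisymmetric.fderiv_rotGen` on `isAxisymmetric_landauSolution`; no swirl is `hasNoSwirl_landauSolution`;
* vorticity at the test point: the explicit pressure derivative `LandauBase.fderiv_landauAxisPressure_apply` (product/chain rules over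
  `hasFDerivAt_norm_of_ne_zero`, `hasFDerivAt_landauDen`, `hasDerivAt_inv`) + `LandauTail.fderiv_landauAxisField_apply` +
  `fderiv_landauBeta_apply` give `(curl U (x₁))₁ = 1/6` (`LandauBase.curl_landau2_xTest_apply_one`);
* non-homogeneity about `e₂`: Euler's relation about the vertex, `DU(x) x = −U(x)` (`LandauBase.fderiv_landauAxisField_self`), so
  homogeneity about `e₂` would force `DU(x₁) e₂ = 0`, but `(DU(x₁) e₂)₀ = 1/250`.

Information for the negation lens only; `PoloidalLiouville` (1222) and NS regularity stay OPEN / NOT proved.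
`--supports stmt-NavierStokesRegularity-1222 --as helper`; 0 kit.  [folklore]
-/

-- the summit and its single problem share the name (D-0017 nested layout)
set_option linter.dupNamespace false

noncomputable section

open Set Function Metric
open scoped RealInnerProductSpace
open Literature.Analysis.FluidPDE

namespace Summit.NavierStokesRegularity.NavierStokesRegularity.Theorems.PoloidalLiouville.AzimuthalCartan

open Summit.NavierStokesRegularity.NavierStokesRegularity.Theorems
open Summit.NavierStokesRegularity.NavierStokesRegularity.Theorems.PoloidalLiouville.CentreJet (E3 IsSteadyNSOn)
open Summit.NavierStokesRegularity.NavierStokesRegularity.Theorems.LandauTail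

open LandauBase

/-- **(L) `LandauBaseFacts` — v1.3b, ON THE SOLID TORUS** (azimuthal-cartan sketch l.339: `IsAxisymmetricBaseOn landauTorus 0 J3 landau2
landauPressure2`, body verbatim with the sketch-local abbreviations `IsAxisymmetricBaseOn`, `IsSkewAxis`, `IsEquivariantOn`, `landauTorus`,
`solidTorus`, `axialCoords`, `e3`, `J3`, `landau2`, `landauPressure2` δ-unfolded into tree vocabulary; `IsSteadyNSOn` is the tree's): on the
rotation-invariant solid torus through `x₁ = (3,0,4)` (axial coordinates within sup-distance `1` of `(3,4)`) the Landau flow with its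
pressure is a real-analytic steady unit-viscosity Navier–Stokes flow, infinitesimally `J₃`-equivariant about the vertex `0` with no swirl,
`J₃ = e₂ × ·` skew and non-zero, and `curl ≠ 0` at `x₁`. [folklore] -/
theorem landauBaseFacts :
    AnalyticOnNhd ℝ (landauAxisField (EuclideanSpace.single 2 1) 2)
        {x : E3 | dist (Real.sqrt (‖x - 0‖ ^ 2 - (inner ℝ (x - 0) (EuclideanSpace.single 2 1 : E3)) ^ 2 /
          ‖(EuclideanSpace.single 2 1 : E3)‖ ^ 2), inner ℝ (x - 0) (EuclideanSpace.single 2 1 : E3) /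
          ‖(EuclideanSpace.single 2 1 : E3)‖) ((3 : ℝ), (4 : ℝ)) < 1} ∧
      AnalyticOnNhd ℝ (landauAxisPressure (EuclideanSpace.single 2 1) 2)
        {x : E3 | dist (Real.sqrt (‖x - 0‖ ^ 2 - (inner ℝ (x - 0) (EuclideanSpace.single 2 1 : E3)) ^ 2 /
          ‖(EuclideanSpace.single 2 1 : E3)‖ ^ 2), inner ℝ (x - 0) (EuclideanSpace.single 2 1 : E3) /
          ‖(EuclideanSpace.single 2 1 : E3)‖) ((3 : ℝ), (4 : ℝ)) < 1} ∧
      IsSteadyNSOn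
        {x : E3 | dist (Real.sqrt (‖x - 0‖ ^ 2 - (inner ℝ (x - 0) (EuclideanSpace.single 2 1 : E3)) ^ 2 /
          ‖(EuclideanSpace.single 2 1 : E3)‖ ^ 2), inner ℝ (x - 0) (EuclideanSpace.single 2 1 : E3) /
          ‖(EuclideanSpace.single 2 1 : E3)‖) ((3 : ℝ), (4 : ℝ)) < 1}
        (landauAxisField (EuclideanSpace.single 2 1) 2) (landauAxisPressure (EuclideanSpace.single 2 1) 2) ∧
      ((∀ x : E3, inner ℝ (crossCLM (EuclideanSpace.single 2 1) x) x = 0) ∧ crossCLM (EuclideanSpace.single 2 1 : E3) ≠ 0) ∧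
      (∀ x ∈ {x : E3 | dist (Real.sqrt (‖x - 0‖ ^ 2 - (inner ℝ (x - 0) (EuclideanSpace.single 2 1 : E3)) ^ 2 /
          ‖(EuclideanSpace.single 2 1 : E3)‖ ^ 2), inner ℝ (x - 0) (EuclideanSpace.single 2 1 : E3) /
          ‖(EuclideanSpace.single 2 1 : E3)‖) ((3 : ℝ), (4 : ℝ)) < 1},
        fderiv ℝ (landauAxisField (EuclideanSpace.single 2 1) 2) x (crossCLM (EuclideanSpace.single 2 1) (x - 0)) =
          crossCLM (EuclideanSpace.single 2 1) (landauAxisField (EuclideanSpace.single 2 1) 2 x)) ∧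
      (∀ x ∈ {x : E3 | dist (Real.sqrt (‖x - 0‖ ^ 2 - (inner ℝ (x - 0) (EuclideanSpace.single 2 1 : E3)) ^ 2 /
          ‖(EuclideanSpace.single 2 1 : E3)‖ ^ 2), inner ℝ (x - 0) (EuclideanSpace.single 2 1 : E3) /
          ‖(EuclideanSpace.single 2 1 : E3)‖) ((3 : ℝ), (4 : ℝ)) < 1},
        inner ℝ (landauAxisField (EuclideanSpace.single 2 1) 2 x) (crossCLM (EuclideanSpace.single 2 1) (x - 0)) = 0) ∧
      ∃ x ∈ {x : E3 | dist (Real.sqrt (‖x - 0‖ ^ 2 - (inner ℝ (x - 0) (EuclideanSpace.single 2 1 : E3)) ^ 2 /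
          ‖(EuclideanSpace.single 2 1 : E3)‖ ^ 2), inner ℝ (x - 0) (EuclideanSpace.single 2 1 : E3) /
          ‖(EuclideanSpace.single 2 1 : E3)‖) ((3 : ℝ), (4 : ℝ)) < 1},
        curl (landauAxisField (EuclideanSpace.single 2 1) 2) x ≠ 0 := by
  have h0 : ∀ x : E3, x - 0 = x - (0 : ℝ) • (EuclideanSpace.single 2 1 : E3) := fun x => by rw [zero_smul]
  refine ⟨fun x hx => analyticAt_landauAxisField norm_e2 one_lt_abs_two (ne_zero_of_mem_torus hx),
    fun x hx => analyticAt_landauAxisPressure norm_e2 one_lt_abs_two (ne_zero_of_mem_torus hx),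
    isSteadyNSOn_landauAxisField norm_e2 one_lt_abs_two fun x hx => ne_zero_of_mem_torus hx,
    ⟨inner_crossCLM_e2_self, crossCLM_e2_ne_zero⟩,
    fun x hx => ?_, fun x _ => ?_, ⟨_, xTest_mem_torus, curl_landau2_xTest_ne_zero⟩⟩
  · rw [h0 x]
    exact fderiv_landau_crossCLM_e2 one_lt_abs_two (ne_zero_of_mem_torus hx) 0
  · rw [h0 x]
    exact inner_landau_crossCLM_e2 2 x 0

/-- **The Landau base about the off-vertex centre `e₂` on small balls about the test point** — the hypothesis `hL` of the sketch's
`ballRigidity_refuted_landau` (v1.3b), body verbatim with the same abbreviations δ-unfolded: for every `0 < ρ ≤ 1`, on `ball x₁ ρ` the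
Landau flow is an admissible axisymmetric base about `(e₂, J₃)` (`J₃ (x − e₂) = e₂ × x`) AND it is NOT `(−1)`-homogeneous about `e₂`
there (Euler about the vertex + `(DU(x₁) e₂)₀ = 1/250`). [folklore] -/
theorem landauBaseFacts_ball_offVertex :
    ∀ ρ : ℝ, 0 < ρ → ρ ≤ 1 →
      (AnalyticOnNhd ℝ (landauAxisField (EuclideanSpace.single 2 1) 2)
          (ball (EuclideanSpace.single 0 3 + EuclideanSpace.single 2 4 : E3) ρ) ∧
        AnalyticOnNhd ℝ (landauAxisPressure (EuclideanSpace.single 2 1) 2)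
          (ball (EuclideanSpace.single 0 3 + EuclideanSpace.single 2 4 : E3) ρ) ∧
        IsSteadyNSOn (ball (EuclideanSpace.single 0 3 + EuclideanSpace.single 2 4 : E3) ρ)
          (landauAxisField (EuclideanSpace.single 2 1) 2) (landauAxisPressure (EuclideanSpace.single 2 1) 2) ∧
        ((∀ x : E3, inner ℝ (crossCLM (EuclideanSpace.single 2 1) x) x = 0) ∧ crossCLM (EuclideanSpace.single 2 1 : E3) ≠ 0) ∧
        (∀ x ∈ ball (EuclideanSpace.single 0 3 + EuclideanSpace.single 2 4 : E3) ρ,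
          fderiv ℝ (landauAxisField (EuclideanSpace.single 2 1) 2) x
              (crossCLM (EuclideanSpace.single 2 1) (x - EuclideanSpace.single 2 1)) =
            crossCLM (EuclideanSpace.single 2 1) (landauAxisField (EuclideanSpace.single 2 1) 2 x)) ∧
        (∀ x ∈ ball (EuclideanSpace.single 0 3 + EuclideanSpace.single 2 4 : E3) ρ,
          inner ℝ (landauAxisField (EuclideanSpace.single 2 1) 2 x)
            (crossCLM (EuclideanSpace.single 2 1) (x - EuclideanSpace.single 2 1)) = 0) ∧
        ∃ x ∈ ball (EuclideanSpace.single 0 3 + EuclideanSpace.single 2 4 : E3) ρ,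
          curl (landauAxisField (EuclideanSpace.single 2 1) 2) x ≠ 0) ∧
      ¬ ∀ x ∈ ball (EuclideanSpace.single 0 3 + EuclideanSpace.single 2 4 : E3) ρ,
          fderiv ℝ (landauAxisField (EuclideanSpace.single 2 1) 2) x (x - EuclideanSpace.single 2 1) =
            -(landauAxisField (EuclideanSpace.single 2 1) 2 x) := by
  intro ρ hρ hρ1
  have hsub : ball (EuclideanSpace.single 0 3 + EuclideanSpace.single 2 4 : E3) ρ ⊆
      ball (EuclideanSpace.single 0 3 + EuclideanSpace.single 2 4 : E3) 1 := ball_subset_ball hρ1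
  have h1 : ∀ x : E3, x - EuclideanSpace.single 2 1 = x - (1 : ℝ) • (EuclideanSpace.single 2 1 : E3) := fun x => by rw [one_smul]
  refine ⟨⟨fun x hx => analyticAt_landauAxisField norm_e2 one_lt_abs_two (ne_zero_of_mem_ball (hsub hx)),
    fun x hx => analyticAt_landauAxisPressure norm_e2 one_lt_abs_two (ne_zero_of_mem_ball (hsub hx)),
    isSteadyNSOn_landauAxisField norm_e2 one_lt_abs_two fun x hx => ne_zero_of_mem_ball (hsub hx),
    ⟨inner_crossCLM_e2_self, crossCLM_e2_ne_zero⟩,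
    fun x hx => ?_, fun x _ => ?_, ⟨_, mem_ball_self hρ, curl_landau2_xTest_ne_zero⟩⟩, not_homogeneous_about_e2 hρ⟩
  · rw [h1 x]
    exact fderiv_landau_crossCLM_e2 one_lt_abs_two (ne_zero_of_mem_ball (hsub hx)) 1
  · rw [h1 x]
    exact inner_landau_crossCLM_e2 2 x 1

end Summit.NavierStokesRegularity.NavierStokesRegularity.Theorems.PoloidalLiouville.AzimuthalCartan
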